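import Summits.QuantumFields.BalabanUV.Beta.GAN24.WrecAtEvenHalfRowsOfTowerEnd
import Summits.QuantumFields.BalabanUV.Beta.D1BFx.ShellRoadEndMean

/-!
# `BalabanUV.Beta.GAN24.RowD1LiteralOfTowerEnd` — binder row G-an2-4 ∕ (CONV-C) → row D1: **THE D1 MEAN-LANE ENDS FOR THE LITERAL OF RECORD
# `RowD1JointEnd.JsRowD1Pin hLc N` WITH NO G-an2-4 ROW LEFT** — road-P2's END OF THE TOWER `WrecAtEvenHalfRowsOfTowerEnd.exists_allScalesSeq_JsRowD1Pin`
# (the (α-0) chain: K-slot, S-slot, the even half of the W-slot, (Q-L), (C)sym, the crossed-value ledger — all inside) PLUGGED INTO road «BF-x»'s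
# socket `RoadEnd.d1Drift_iff_cesaro` ∕ `d1Drift_of_meanRoad` ∕ `d1Drift_of_meanRoad_table` ∕ `ShellRoadEndMean.d1Drift_of_meanRoad_table_shell` and
# `HessKerDressedCauchy.d1Drift_iff_lim_eq`: the slot-free twins of `D1BFx.RoadEndRowPinned` §2–§3 and of `WSlotParityJunction.d1Drift_JsRowD1Pin_iff_cesaro_of_slots_evenHalf`
# (G-an2-4 formalisation swarm, leaf prover `b2b-balaban-gan24-formalise-leaf-01` gen 78)

NOT IN PRINT; OUR BOOKKEEPING ([folklore] composition BY NAME; 0 `def`, 0 cited facts, 0 `def … : Prop`, 0 sorry).  HONEST FRAMING (cell contract, verbatim):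
«discharging `BetaPertH` makes Bałaban's UV stability UNCONDITIONAL — a real constructive-QFT result; it is NOT the continuum limit and NOT the Clay problem.»
HONEST DEPENDENCY (verbatim): «continuum YM on T⁴ ⇐ BetaPertH ∧ nine spine estimates (0/9 proved); BetaPertH ⇐ (D1) ∧ (D4) ∧ CAP+tail; G-an2-4 gates asym,
D1 and NE2/3/4.»

WHAT (`d + 1 = 4`; `Lc` odd, `2 ≤ Lc`; Wilson colour `2 ≤ N`; every channel `(μ, ν)`; every slope parameter `Nc : ℝ` of `D1Drift`, kept apart from `N`):
* §1 **`exists_allScalesSeq_JsRowD1Pin`** — road «BF-x»'s `hall ∕ hθ0 ∕ hθ1` binders for the literal of record, in their binder shape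
  `∃ κ θ, 0 ≤ θ ∧ θ < 1 ∧ AllScalesSeq (j ↦ secondMoment (TbalOf Lc (JsRowD1Pin hLc N) j) μ ν) κ θ`, with NO S-∕W-slot row, NO radius, NO rate as hypothesis:
  road-P2's END with its seven pin-NAME equations (`r`, `cE`, `cVH`, `cΛ`, `cE₂`, `cB`, `vh₂S`) instantiated by `rfl`.
* §2 **`tendsto_secondMoment_JsRowD1Pin`** ∕ **`exists_geomRate_secondMoment_JsRowD1Pin`** — the step coefficients `β⁰_j` of the literal of record CONVERGE
  (to `CauchyRate.lim β⁰`, with a geometric rate `|β⁰_k − lim| ≤ κ·θ^k`, `θ < 1`) — hypotheses `Odd Lc`, `2 ≤ Lc`, `2 ≤ N` ONLY; the VALUE of the limit is NOT computed;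
  **`d1Drift_JsRowD1Pin_iff_lim_eq`** ∕ **`d1Drift_JsRowD1Pin_iff_cesaro`** — FOR THE LITERAL OF RECORD THE WALL's TERM `D1Drift Lc (JsRowD1Pin hLc N) Nc μ ν`
  IS EXACTLY THE VALUE IDENTITY: `CauchyRate.lim (j ↦ β⁰_j) = stepBal Nc Lc`, equivalently `(Σ_{j<m} β⁰_j)∕m → stepBal Nc Lc` — hypotheses `Odd Lc`, `2 ≤ Lc`,
  `2 ≤ N` ONLY.
* §3 **`d1Drift_JsRowD1Pin_of_meanRoad`** ((B1_mean) ∧ (T_mean) ⟹ `D1Drift`), **`d1Drift_JsRowD1Pin_of_meanRoad_table`** (table currency, an3's six pointwise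
  scalar rows), **`d1Drift_JsRowD1Pin_of_meanRoad_table_shell`** (table currency, the SHELL far rows h2s ∕ d2s of record) — `RoadEndRowPinned` §3 with the
  twelve slot binders `hS hSall hW hWall hδS hδW hθS0 hθS1 hθW0 hθW1` (+ `Cs cS Cw cW`) GONE.
READING (zero weight beyond the composition): after road-P2's END the D1 row for the literal of record owes row G-an2-4 NOTHING — what it owes is the VALUE
(B1_mean ∧ T_mean, or the limit identity of §2), i.e. road «BF-x»'s own displayed debt.  Discharges NOTHING of that debt; NOT «D1 closed»; NEVER «G-an2-4
closed» as (CONV-C) (the fine-lattice constituents and the full W-slot `(hW, hWall)` of the wall are not touched); NOT `BetaPertH`, NOT continuum, NOT Clay.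
2026-08-25; no existing file touched.
-/

noncomputable section

open Finset Filter Topology
open scoped BigOperators
open Literature.Probability.LatticeModels (annulus)
open Literature.MathematicalPhysics.QuantumFieldTheory
open Literature.MathematicalPhysics.QuantumFieldTheory.Balaban1983to89
open Literature.MathematicalPhysics.QuantumFieldTheory.Balaban1983to89.Beta
open RemainderConstAllScales (AllScalesSeq)
open OneStepResolventKernel (JetData)
open OneStepKernelFamily (TbalOf D1Drift)
open HessKerDressedCauchy (d1Drift_iff_lim_eq)
open WindowIdentification (fullSum)
open DyadicShell (Pt supNorm)
open SquareTable (stK)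
open GhostTable (gFree)
open BubbleTransfer (unitVec)
open AveragingContoursRooted (ctrOff)
open Summit.QuantumFields.BalabanUV.Beta.RowD1JointEnd (JsRowD1Pin)
open Summit.QuantumFields.BalabanUV.Beta.D1BFx.RoadEnd (d1Drift_iff_cesaro d1Drift_of_meanRoad d1Drift_of_meanRoad_table)
open Summit.QuantumFields.BalabanUV.Beta.D1BFx.ShellRoadEndMean (d1Drift_of_meanRoad_table_shell)

namespace Summit.QuantumFields.BalabanUV.Beta.GAN24.RowD1LiteralOfTowerEnd

/-! ## §1 Road «BF-x»'s `hall` binder for the literal of record — no slot row -/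

/-- NOT IN PRINT; OUR BOOKKEEPING ([folklore] composition BY NAME).  **THE ALL-SCALES BOUND OF THE STEP COEFFICIENTS OF THE LITERAL OF RECORD, SLOT-FREE**
(`Lc` odd, `2 ≤ Lc`, `2 ≤ N`, every channel): `∃ κ θ, 0 ≤ θ ∧ θ < 1 ∧ AllScalesSeq (j ↦ secondMoment (TbalOf Lc (JsRowD1Pin hLc N) j) μ ν) κ θ` — road-P2's END OF THE TOWER
`WrecAtEvenHalfRowsOfTowerEnd.exists_allScalesSeq_JsRowD1Pin` with its seven pin-name equations closed by `rfl`; the binder shape of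
`D1BFx.RoadEndRowPinned.exists_allScalesSeq_JsRowD1Pin_of_slots` without its twelve slot hypotheses. -/
theorem exists_allScalesSeq_JsRowD1Pin {Lc : ℕ} [NeZero Lc] (hLc : Odd Lc) (hL2 : 2 ≤ Lc) {N : ℕ} (hN : 2 ≤ N)
    (μ ν : Fin 4) :
    ∃ κ θ : ℝ, 0 ≤ θ ∧ θ < 1 ∧ AllScalesSeq (fun j => B12Beta.secondMoment (TbalOf Lc (JsRowD1Pin hLc N) j) μ ν) κ θ :=
  WrecAtEvenHalfRowsOfTowerEnd.exists_allScalesSeq_JsRowD1Pin hLc hL2 hN (r := ctrOff (3 + 1) Lc) rfl rfl rfl rfl rfl rfl rfl μ ν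

/-! ## §2 For the literal of record: the UV limit of the step coefficients EXISTS (geometric rate), and the wall's term is the value identity -/

/-- NOT IN PRINT; OUR BOOKKEEPING.  **THE STEP COEFFICIENTS OF THE LITERAL OF RECORD CONVERGE** (`Lc` odd, `2 ≤ Lc`, `2 ≤ N`; every channel `(μ, ν)`):
`β⁰_j := secondMoment (TbalOf Lc (JsRowD1Pin hLc N) j) μ ν → CauchyRate.lim β⁰` as `j → ∞` (`AllScalesSeq.tendsto_lim` at §1's `hall`).  The VALUE of the limit
is NOT computed here (that is road «BF-x»'s (T_mean) ∕ the identification with `stepBal`). -/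
theorem tendsto_secondMoment_JsRowD1Pin {Lc : ℕ} [NeZero Lc] (hLc : Odd Lc) (hL2 : 2 ≤ Lc) {N : ℕ} (hN : 2 ≤ N)
    (μ ν : Fin 4) :
    Tendsto (fun j => B12Beta.secondMoment (TbalOf Lc (JsRowD1Pin hLc N) j) μ ν) atTop
      (𝓝 (RateCertificate.CauchyRate.lim (fun j => B12Beta.secondMoment (TbalOf Lc (JsRowD1Pin hLc N) j) μ ν))) := by
  obtain ⟨κ, θ, -, hθ1, hall⟩ := exists_allScalesSeq_JsRowD1Pin hLc hL2 hN μ ν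
  exact hall.tendsto_lim hθ1

/-- NOT IN PRINT; OUR BOOKKEEPING.  **… WITH A GEOMETRIC RATE ABOUT THE LIMIT**: `∃ κ θ, 0 ≤ θ ∧ θ < 1 ∧ GeomRate β⁰ (CauchyRate.lim β⁰) κ θ`, i.e.
`|β⁰_k − lim β⁰| ≤ κ·θ^k` for every `k` (`AllScalesSeq.geomRate` at §1's `hall`, same `κ`, same `θ`). -/
theorem exists_geomRate_secondMoment_JsRowD1Pin {Lc : ℕ} [NeZero Lc] (hLc : Odd Lc) (hL2 : 2 ≤ Lc) {N : ℕ} (hN : 2 ≤ N)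
    (μ ν : Fin 4) :
    ∃ κ θ : ℝ, 0 ≤ θ ∧ θ < 1 ∧ RateCertificate.GeomRate (fun j => B12Beta.secondMoment (TbalOf Lc (JsRowD1Pin hLc N) j) μ ν)
      (RateCertificate.CauchyRate.lim (fun j => B12Beta.secondMoment (TbalOf Lc (JsRowD1Pin hLc N) j) μ ν)) κ θ := by
  obtain ⟨κ, θ, hθ0, hθ1, hall⟩ := exists_allScalesSeq_JsRowD1Pin hLc hL2 hN μ ν
  exact ⟨κ, θ, hθ0, hθ1, hall.geomRate hθ1⟩


/-- NOT IN PRINT; OUR BOOKKEEPING.  **`D1Drift` FOR THE LITERAL OF RECORD ⟺ THE LIMIT OF ITS STEP COEFFICIENTS IS `stepBal Nc Lc`** (`Lc` odd, `2 ≤ Lc`, `2 ≤ N`; every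
channel `(μ, ν)`, every `Nc`): `HessKerDressedCauchy.d1Drift_iff_lim_eq` at §1's `hall`.  The limit object is `CauchyRate.lim` of the coefficient sequence. -/
theorem d1Drift_JsRowD1Pin_iff_lim_eq {Lc : ℕ} [NeZero Lc] (hLc : Odd Lc) (hL2 : 2 ≤ Lc) {N : ℕ} (hN : 2 ≤ N)
    (μ ν : Fin 4) (Nc : ℝ) :
    D1Drift Lc (JsRowD1Pin hLc N) Nc μ ν ↔
      RateCertificate.CauchyRate.lim (fun j => B12Beta.secondMoment (TbalOf Lc (JsRowD1Pin hLc N) j) μ ν) = B12Normalization.stepBal Nc Lc := by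
  obtain ⟨κ, θ, hθ0, hθ1, hall⟩ := exists_allScalesSeq_JsRowD1Pin hLc hL2 hN μ ν
  exact d1Drift_iff_lim_eq _ hall hθ0 hθ1 Nc

/-- NOT IN PRINT; OUR BOOKKEEPING.  **`D1Drift` FOR THE LITERAL OF RECORD ⟺ THE CESÀRO MEANS OF ITS STEP COEFFICIENTS TEND TO `stepBal Nc Lc`** (`Lc` odd, `2 ≤ Lc`,
`2 ≤ N`): `D1BFx.RoadEnd.d1Drift_iff_cesaro` at §1's `hall` — the slot-free twin of `RoadEndRowPinned.d1Drift_JsRowD1Pin_iff_cesaro_of_slots` and of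
`WSlotParityJunction.d1Drift_JsRowD1Pin_iff_cesaro_of_slots_evenHalf`. -/
theorem d1Drift_JsRowD1Pin_iff_cesaro {Lc : ℕ} [NeZero Lc] (hLc : Odd Lc) (hL2 : 2 ≤ Lc) {N : ℕ} (hN : 2 ≤ N)
    (μ ν : Fin 4) (Nc : ℝ) :
    D1Drift Lc (JsRowD1Pin hLc N) Nc μ ν ↔
      Tendsto (fun m : ℕ => (∑ j ∈ range m, B12Beta.secondMoment (TbalOf Lc (JsRowD1Pin hLc N) j) μ ν) / (m : ℝ)) atTop
        (𝓝 (B12Normalization.stepBal Nc Lc)) := by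
  obtain ⟨κ, θ, hθ0, hθ1, hall⟩ := exists_allScalesSeq_JsRowD1Pin hLc hL2 hN μ ν
  exact d1Drift_iff_cesaro _ hall hθ0 hθ1 Nc

/-! ## §3 The mean-grading road ENDs for the literal of record — no slot row -/

/-- NOT IN PRINT; OUR BOOKKEEPING.  **THE MEAN ROAD END FOR THE LITERAL OF RECORD, SLOT-FREE**: (B1_mean) a Cesàro-null telescoping defect of the step coefficients
against a one-shot coefficient `c (Lc^m)` (free) ∧ (T_mean) `c (Lc^m)∕m → stepBal Nc Lc` ⟹ `D1Drift Lc (JsRowD1Pin hLc N) Nc μ ν` (`D1BFx.RoadEnd.d1Drift_of_meanRoad` at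
§1's `hall`).  (B1_mean) and (T_mean) are HYPOTHESES — road «BF-x»'s displayed debt, not row G-an2-4's. -/
theorem d1Drift_JsRowD1Pin_of_meanRoad {Lc : ℕ} [NeZero Lc] (hLc : Odd Lc) (hL2 : 2 ≤ Lc) {N : ℕ} (hN : 2 ≤ N)
    (μ ν : Fin 4) (Nc : ℝ) (c : ℕ → ℝ)
    (hB1 : Tendsto (fun m : ℕ => ((∑ j ∈ range m, B12Beta.secondMoment (TbalOf Lc (JsRowD1Pin hLc N) j) μ ν) - c (Lc ^ m)) / (m : ℝ))
      atTop (𝓝 0))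
    (hT : Tendsto (fun m : ℕ => c (Lc ^ m) / (m : ℝ)) atTop (𝓝 (B12Normalization.stepBal Nc Lc))) :
    D1Drift Lc (JsRowD1Pin hLc N) Nc μ ν := by
  obtain ⟨κ, θ, hθ0, hθ1, hall⟩ := exists_allScalesSeq_JsRowD1Pin hLc hL2 hN μ ν
  exact d1Drift_of_meanRoad _ hall hθ0 hθ1 Nc c hB1 hT

/-- NOT IN PRINT; OUR BOOKKEEPING.  **THE MEAN ROAD END FOR THE LITERAL OF RECORD, TABLE CURRENCY, POINTWISE ROWS, SLOT-FREE**: (B1_mean), the MEAN target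
`(c (Lc^m) − Σ_b wt·fullSum (stK μ ν Nc (Gf (Lc^m) b)))∕m → 0` over a scalar leg family `Gf` with convex base-point weights, and an3's six graded scalar rows
`h0∕h1∕h2∕d0∕d1∕d2` for `Gf` ⟹ `D1Drift Lc (JsRowD1Pin hLc N) Nc μ ν` (`D1BFx.RoadEnd.d1Drift_of_meanRoad_table` at §1's `hall`). -/
theorem d1Drift_JsRowD1Pin_of_meanRoad_table {Lc : ℕ} [NeZero Lc] (hLc : Odd Lc) (hL2 : 2 ≤ Lc) {N : ℕ} (hN : 2 ≤ N)
    {κB : Type*} {μ ν : Fin 4} (hμν : μ ≠ ν) {Nc : ℝ} (hNc : Nc ≠ 0) (c : ℕ → ℝ)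
    {Bset : ℕ → Finset κB} {wt : ℕ → κB → ℝ} {Gf : ℕ → κB → Pt → ℝ} {D A : ℕ → ℝ}
    (hD : ∀ j, 0 ≤ D j) (hA : ∀ j, 0 ≤ A j) {δ : ℝ} (hδ : 0 < δ)
    (hwt0 : ∀ n : ℕ, 2 ≤ n → ∀ b ∈ Bset n, 0 ≤ wt n b) (hwt1 : ∀ n : ℕ, 2 ≤ n → ∑ b ∈ Bset n, wt n b = 1)
    (h0 : ∀ n : ℕ, 2 ≤ n → ∀ b ∈ Bset n, ∀ v, |Gf n b v - gFree v| ≤ D 0 / (n : ℝ) ^ 2)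
    (h1 : ∀ n : ℕ, 2 ≤ n → ∀ b ∈ Bset n, ∀ v (ρ : Fin 4),
      |(Gf n b (v + unitVec ρ) - gFree (v + unitVec ρ)) - (Gf n b v - gFree v)| ≤ D 1 / (n : ℝ) ^ 3)
    (h2 : ∀ n : ℕ, 2 ≤ n → ∀ b ∈ Bset n, ∀ v,
      |(Gf n b (v + unitVec ν + unitVec μ) - gFree (v + unitVec ν + unitVec μ)) - (Gf n b (v + unitVec ν) - gFree (v + unitVec ν)) -
          (Gf n b (v + unitVec μ) - gFree (v + unitVec μ)) + (Gf n b v - gFree v)| ≤ D 2 / (n : ℝ) ^ 4)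
    (d0 : ∀ n : ℕ, 2 ≤ n → ∀ b ∈ Bset n, ∀ v : Pt, v ≠ 0 → |Gf n b v| ≤ A 0 * Real.exp (-(δ / n) * supNorm v) / (supNorm v : ℝ) ^ 2)
    (d1 : ∀ n : ℕ, 2 ≤ n → ∀ b ∈ Bset n, ∀ v : Pt, v ≠ 0 → ∀ ρ : Fin 4,
      |Gf n b (v + unitVec ρ) - Gf n b v| ≤ A 1 * Real.exp (-(δ / n) * supNorm v) / (supNorm v : ℝ) ^ 3)
    (d2 : ∀ n : ℕ, 2 ≤ n → ∀ b ∈ Bset n, ∀ v : Pt, v ≠ 0 →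
      |Gf n b (v + unitVec ν + unitVec μ) - Gf n b (v + unitVec ν) - Gf n b (v + unitVec μ) + Gf n b v| ≤
        A 2 * Real.exp (-(δ / n) * supNorm v) / (supNorm v : ℝ) ^ 4)
    (hB1 : Tendsto (fun m : ℕ => ((∑ j ∈ range m, B12Beta.secondMoment (TbalOf Lc (JsRowD1Pin hLc N) j) μ ν) - c (Lc ^ m)) / (m : ℝ))
      atTop (𝓝 0))
    (hT : Tendsto (fun m : ℕ => (c (Lc ^ m) - ∑ b ∈ Bset (Lc ^ m), wt (Lc ^ m) b * fullSum (stK μ ν Nc (Gf (Lc ^ m) b))) / (m : ℝ))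
      atTop (𝓝 0)) :
    D1Drift Lc (JsRowD1Pin hLc N) Nc μ ν := by
  obtain ⟨κ, θ, hθ0, hθ1, hall⟩ := exists_allScalesSeq_JsRowD1Pin hLc hL2 hN μ ν
  exact d1Drift_of_meanRoad_table _ hμν hNc hL2 hall hθ0 hθ1 c hD hA hδ hwt0 hwt1 h0 h1 h2 d0 d1 d2 hB1 hT

/-- NOT IN PRINT; OUR BOOKKEEPING.  **THE MEAN ROAD END FOR THE LITERAL OF RECORD, TABLE CURRENCY, SHELL FAR ROWS OF RECORD, SLOT-FREE**: as the previous END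
with the mixed second-difference rows h2 ∕ d2 in their SHELL-ℓ¹ forms `h2s` ∕ `d2s` (`D1BFx.ShellRoadEndMean.d1Drift_of_meanRoad_table_shell` at §1's `hall`)
— the slot-free twin of `RoadEndRowPinned.d1Drift_JsRowD1Pin_of_meanRoad_table_shell_of_slots`. -/
theorem d1Drift_JsRowD1Pin_of_meanRoad_table_shell {Lc : ℕ} [NeZero Lc] (hLc : Odd Lc) (hL2 : 2 ≤ Lc) {N : ℕ} (hN : 2 ≤ N)
    {κB : Type*} {μ ν : Fin 4} (hμν : μ ≠ ν) {Nc : ℝ} (hNc : Nc ≠ 0) (c : ℕ → ℝ)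
    {Bset : ℕ → Finset κB} {wt : ℕ → κB → ℝ} {Gf : ℕ → κB → Pt → ℝ} {D A : ℕ → ℝ}
    (hD : ∀ j, 0 ≤ D j) (hA : ∀ j, 0 ≤ A j) {δ : ℝ} (hδ : 0 < δ)
    (hwt0 : ∀ n : ℕ, 2 ≤ n → ∀ b ∈ Bset n, 0 ≤ wt n b) (hwt1 : ∀ n : ℕ, 2 ≤ n → ∑ b ∈ Bset n, wt n b = 1)
    (h0 : ∀ n : ℕ, 2 ≤ n → ∀ b ∈ Bset n, ∀ v, |Gf n b v - gFree v| ≤ D 0 / (n : ℝ) ^ 2)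
    (h1 : ∀ n : ℕ, 2 ≤ n → ∀ b ∈ Bset n, ∀ v (ρ : Fin 4),
      |(Gf n b (v + unitVec ρ) - gFree (v + unitVec ρ)) - (Gf n b v - gFree v)| ≤ D 1 / (n : ℝ) ^ 3)
    (h2s : ∀ n : ℕ, 2 ≤ n → ∀ b ∈ Bset n, ∀ r : ℕ, r + 1 ≤ n →
      ∑ v ∈ annulus 4 r (r + 1), |(Gf n b (v + unitVec ν + unitVec μ) - gFree (v + unitVec ν + unitVec μ)) -
          (Gf n b (v + unitVec ν) - gFree (v + unitVec ν)) - (Gf n b (v + unitVec μ) - gFree (v + unitVec μ)) +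
          (Gf n b v - gFree v)| ≤ D 2 / (n : ℝ))
    (d0 : ∀ n : ℕ, 2 ≤ n → ∀ b ∈ Bset n, ∀ v : Pt, v ≠ 0 → |Gf n b v| ≤ A 0 * Real.exp (-(δ / n) * supNorm v) / (supNorm v : ℝ) ^ 2)
    (d1 : ∀ n : ℕ, 2 ≤ n → ∀ b ∈ Bset n, ∀ v : Pt, v ≠ 0 → ∀ ρ : Fin 4,
      |Gf n b (v + unitVec ρ) - Gf n b v| ≤ A 1 * Real.exp (-(δ / n) * supNorm v) / (supNorm v : ℝ) ^ 3)
    (d2s : ∀ n : ℕ, 2 ≤ n → ∀ b ∈ Bset n, ∀ r : ℕ, n ≤ r →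
      ∑ v ∈ annulus 4 r (r + 1), |Gf n b (v + unitVec ν + unitVec μ) - Gf n b (v + unitVec ν) - Gf n b (v + unitVec μ) + Gf n b v| ≤
        A 2 * Real.exp (-(δ / n) * ((r : ℝ) + 1)) / ((r : ℝ) + 1))
    (hB1 : Tendsto (fun m : ℕ => ((∑ j ∈ range m, B12Beta.secondMoment (TbalOf Lc (JsRowD1Pin hLc N) j) μ ν) - c (Lc ^ m)) / (m : ℝ))
      atTop (𝓝 0))
    (hT : Tendsto (fun m : ℕ => (c (Lc ^ m) - ∑ b ∈ Bset (Lc ^ m), wt (Lc ^ m) b * fullSum (stK μ ν Nc (Gf (Lc ^ m) b))) / (m : ℝ))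
      atTop (𝓝 0)) :
    D1Drift Lc (JsRowD1Pin hLc N) Nc μ ν := by
  obtain ⟨κ, θ, hθ0, hθ1, hall⟩ := exists_allScalesSeq_JsRowD1Pin hLc hL2 hN μ ν
  exact d1Drift_of_meanRoad_table_shell _ hμν hNc hL2 hall hθ0 hθ1 c hD hA hδ hwt0 hwt1 h0 h1 h2s d0 d1 d2s hB1 hT

end Summit.QuantumFields.BalabanUV.Beta.GAN24.RowD1LiteralOfTowerEnd

end
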